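import Summits.Ventures.HSemireg.WedgeHankelMobius

/-!
# Venture HSemireg — THE GENERAL LINEAR SUBSTITUTION OF THE FRAME LETTERS AS ONE THEOREM: `x_a ↦ αx_a + βy_a`, `y_a ↦ γx_a + δy_a` (any `α β γ δ`, also singular)
# carries th-7's class `w_m(q)` to `w_m(sbSeq m q)`; E5 `Φs` / E7 `Ψs` / E12 `Δs` / F1 `Ls` / F5 `Xsc` are instances, and words in them are matrix products

HONEST FRAMING. Part of the Lean index of the computation cell `pub-hsemireg` (seat p10 gen 18, Sunday typer «UNIFORM-IN-n»).
Finite-dimensional EXTERIOR ALGEBRA over a field ONLY: no variety, no cohomology theory, no sheaf, no Ext group, no semiregularity map;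
nothing here says that HC / HC_CM / HC_AV holds; no Literature fact is declared or used.  Custodian versions as in `WedgeHankelSiegelIdeal` (1/3) and `WedgeHankelFrameChange`;
the dictionary (`v = Σ_j q_j Θ^j/j!` ↦ `w_n(q)`; a linear substitution of the frame `(x_a, y_a) ↦ (αx_a + βy_a, γx_a + δy_a)`, the same matrix for every pair `a`, i.e. a change of
the complex frame; its action on the coefficient sequence = the action of `GL₂` on the moments of a binary form of degree `n`) is QUOTED, never asserted.

WHAT IS IN THE TREE.  The four generators of the lineage, each with its own automorphism, its own coefficient transform and its own proof by th-7's recursion: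
E5 `Φs λ` (`x ↦ x + λy`; `Φs_w`: `expMul λ`), E7 `Ψs` (`x ↔ y`; `Ψs_w`: `rev_n`), E12 `Δs μ` (`y ↦ μy`; `Δs_w`: `scaleSeq μ`), F1 `Ls c` (`y ↦ y + cx`; `Ls_w`: `lowMul c`), F5 `Xsc d`
(`x ↦ dx`; `Xsc_w`: `xsSeq d`); `algHom_ext_XY`; `Kr_mapEquiv` / `V_mapEquiv` (transport along any automorphism induced from the generators); `map_Φs_siegelIdeal` etc. (each
generator fixes `SI_k`).  F5's header: «NOT typed here: a syntax of words in the generators with the induced `PGL₂`-action … as one theorem».  THIS FILE types it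
(namespace `Summit.Ventures.HSemireg.Wedge.HankelFrameChange` continued):
* §120 the substitution `sbLin α β γ δ` of the generators (`e_{x_a} ↦ α e_{x_a} + β e_{y_a}`, `e_{y_a} ↦ γ e_{x_a} + δ e_{y_a}`) and the induced algebra ENDOMORPHISM
  **`Sb α β γ δ := ExteriorAlgebra.map (sbLin α β γ δ)`** of `⋀(K^{2n})` (`Sb_X`, `Sb_Y`) — defined for EVERY `α β γ δ`, singular substitutions included.
* §121 the MOMENT TRANSFORM **`sbSeq α β γ δ m q`** by the double recursion `(m+1, 0) ↦ α·(m, q, 0) + γ·(m, σq, 0)`, `(m+1, j+1) ↦ β·(m, q, j) + δ·(m, σq, j)` (linear in `q`;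
  `sbSeq_succ_of_le`: the `x`-identity `sbSeq (m+1) q j = α·sbSeq m q j + γ·sbSeq m (σq) j` for `j ≤ m`), and THE ONE THEOREM **`Sb_w`: `Sb α β γ δ (w_m(q)) = w_m(sbSeq α β γ δ m q)`**
  for every `m ≤ n`, every `q` and EVERY `α β γ δ` (th-7's recursion once, for all generators at the same time).
* §122 the generators are instances: `sbSeq 1 λ 0 1 = expMul λ`, `sbSeq 0 1 1 0 m = rev_m`, `sbSeq 1 0 0 μ = scaleSeq μ`, `sbSeq 1 0 c 1 n = lowMul c`, `sbSeq d 0 0 1 n = xsSeq d` (on `[0, m]`),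
  and `Φs λ = Sb 1 λ 0 1`, `Ψs = Sb 0 1 1 0`, `Δs μ = Sb 1 0 0 μ`, `Ls c = Sb 1 0 c 1`, `Xsc d = Sb d 0 0 1` as algebra maps — E5/E7/E12/F1/F5's `_w` theorems are the corresponding instances of `Sb_w` (`w_expMul_eq_w_sbSeq`, `w_lowMul_eq_w_sbSeq`, `w_xsSeq_eq_w_sbSeq`).
* §123 WORDS ARE MATRIX PRODUCTS: **`Sb_comp`: `Sb α′ β′ γ′ δ′ ∘ Sb α β γ δ = Sb (αα′+βγ′) (αβ′+βδ′) (γα′+δγ′) (γβ′+δδ′)`** (substitutions compose contravariantly), `Sb_one`; the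
  singular substitution `Sb 1 λ 0 0` (`y ↦ 0`) sends EVERY class to the pure class `q_0·vol_λ` (`Sb_w_rank_one`).
NOT typed here (next leaf `WedgeHankelSubstitutionSiegel`): `Sb (s_{ab}) = (αδ − βγ)·s_{ab}`, `Sb(SI_k) ≤ SI_k`, and for `αδ − βγ ≠ 0` the automorphism with the transport of
kernels / images and the invariance of every Hankel rank; then the action on NODE classes / divisors (the Möbius map on the nodes); the composition law on the coefficient
side as a sequence identity (it follows from `Sb_comp` and the injectivity of `q|[0,n] ↦ w_n(q)`); anything Ext-side.  Class side only; new names only.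
-/

open Module

namespace Summit.Ventures.HSemireg.Wedge.HankelFrameChange

open Summit.Ventures.HSemireg.Wedge Summit.Ventures.HSemireg.Wedge.Kunneth Summit.Ventures.HSemireg.Wedge.Hankel
  Summit.Ventures.HSemireg.Wedge.BasisFree Summit.Ventures.HSemireg.Wedge.HankelSiegel Summit.Ventures.HSemireg.Wedge.HankelSiegelIdeal
  Summit.Ventures.HSemireg.Wedge.KunnethKernel Summit.Ventures.HSemireg.Wedge.HankelRankOne

variable (K : Type*) [Field K] {n : ℕ}

/-! ## §120. The general linear substitution of the frame letters -/

/-- **THE SUBSTITUTION on the generators**: `e_{x_a} ↦ α e_{x_a} + β e_{y_a}`, `e_{y_a} ↦ γ e_{x_a} + δ e_{y_a}` (the same `2 × 2` matrix for every pair `a`), as the linear map of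
`K^{2n}` with these values on the standard basis. -/
noncomputable def sbLin (α β γ δ : K) : (In n → K) →ₗ[K] (In n → K) :=
  (b K (In n)).constr K fun i : In n =>
    if n ≤ (i : ℕ) then γ • b K (In n) (partner i) + δ • b K (In n) i else α • b K (In n) i + β • b K (In n) (partner i)

/-- the substitution on a basis vector. -/
lemma sbLin_b (α β γ δ : K) (i : In n) :
    sbLin K α β γ δ (b K (In n) i) = if n ≤ (i : ℕ) then γ • b K (In n) (partner i) + δ • b K (In n) i else α • b K (In n) i + β • b K (In n) (partner i) := by
  rw [sbLin, Basis.constr_basis]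

/-- **`e_{x_a} ↦ α e_{x_a} + β e_{y_a}`.** -/
lemma sbLin_b_castAdd (α β γ δ : K) (a : Fin n) :
    sbLin K α β γ δ (b K (In n) (Fin.castAdd n a)) = α • b K (In n) (Fin.castAdd n a) + β • b K (In n) (Fin.natAdd n a) := by
  have h : ¬ n ≤ ((Fin.castAdd n a : In n) : ℕ) := by rw [Fin.val_castAdd]; exact Nat.not_le.mpr a.2
  rw [sbLin_b, if_neg h, partner_castAdd]

/-- **`e_{y_a} ↦ γ e_{x_a} + δ e_{y_a}`.** -/
lemma sbLin_b_natAdd (α β γ δ : K) (a : Fin n) :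
    sbLin K α β γ δ (b K (In n) (Fin.natAdd n a)) = γ • b K (In n) (Fin.castAdd n a) + δ • b K (In n) (Fin.natAdd n a) := by
  have h : n ≤ ((Fin.natAdd n a : In n) : ℕ) := by rw [Fin.val_natAdd]; exact Nat.le_add_right n a
  rw [sbLin_b, if_pos h, partner_natAdd]

/-- **THE SUBSTITUTION ENDOMORPHISM `Sb α β γ δ := ExteriorAlgebra.map (sbLin α β γ δ)`** of `⋀(K^{2n})` — an algebra map for EVERY `α β γ δ` (not assumed invertible). -/
noncomputable def Sb (α β γ δ : K) : HT K (In n) →ₐ[K] HT K (In n) := ExteriorAlgebra.map (sbLin K (n := n) α β γ δ)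

/-- `Sb (ι v) = ι (sbLin v)`. -/
lemma Sb_ι (α β γ δ : K) (v : In n → K) : Sb K α β γ δ (ExteriorAlgebra.ι K v) = ExteriorAlgebra.ι K (sbLin K α β γ δ v) :=
  ExteriorAlgebra.map_apply_ι _ _

/-- **`Sb (x_a) = α x_a + β y_a`.** -/
theorem Sb_X (α β γ δ : K) (a : Fin n) : Sb K α β γ δ (X K n a) = α • X K n a + β • Y K n a := by
  rw [X_fin, Sb_ι, sbLin_b_castAdd, map_add, map_smul, map_smul, ← X_fin, ← Y_fin]

/-- **`Sb (y_a) = γ x_a + δ y_a`.** -/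
theorem Sb_Y (α β γ δ : K) (a : Fin n) : Sb K α β γ δ (Y K n a) = γ • X K n a + δ • Y K n a := by
  rw [Y_fin, Sb_ι, sbLin_b_natAdd, map_add, map_smul, map_smul, ← X_fin, ← Y_fin]

/-- `Sb (X_c) = α X_c + β Y_c`, `ℕ`-indexed (both sides `0` beyond `n`). -/
lemma Sb_X' (α β γ δ : K) (c : ℕ) : Sb K α β γ δ (X K n c) = α • X K n c + β • Y K n c := by
  by_cases hc : c < n
  · exact Sb_X K α β γ δ ⟨c, hc⟩
  · rw [X, Y, dif_neg hc, dif_neg hc, map_zero, smul_zero, smul_zero, add_zero]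

/-- `Sb (Y_c) = γ X_c + δ Y_c`, `ℕ`-indexed. -/
lemma Sb_Y' (α β γ δ : K) (c : ℕ) : Sb K α β γ δ (Y K n c) = γ • X K n c + δ • Y K n c := by
  by_cases hc : c < n
  · exact Sb_Y K α β γ δ ⟨c, hc⟩
  · rw [X, Y, dif_neg hc, dif_neg hc, map_zero, smul_zero, smul_zero, add_zero]

/-! ## §121. The moment transform and the one theorem -/

/-- **THE MOMENT TRANSFORM `sbSeq α β γ δ m q`** of a coefficient sequence under the substitution, by the double recursion
`sbSeq 0 q 0 = q_0`, `sbSeq (m+1) q 0 = α·sbSeq m q 0 + γ·sbSeq m (σq) 0`, `sbSeq (m+1) q (j+1) = β·sbSeq m q j + δ·sbSeq m (σq) j` (and `0` beyond `m`).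
Dictionary (quoted): the moments `q_j = L(u^{m−j}v^j)` of a linear functional `L` on binary forms of degree `m` become `L((αu+γv)^{m−j}(βu+δv)^j)`. -/
def sbSeq (α β γ δ : K) : ℕ → (ℕ → K) → ℕ → K
  | 0, q, 0 => q 0
  | 0, _, _ + 1 => 0
  | m + 1, q, 0 => α * sbSeq α β γ δ m q 0 + γ * sbSeq α β γ δ m (shift K q) 0
  | m + 1, q, j + 1 => β * sbSeq α β γ δ m q j + δ * sbSeq α β γ δ m (shift K q) j

/-- `sbSeq 0 q 0 = q_0`. -/
@[simp] lemma sbSeq_zero_zero (α β γ δ : K) (q : ℕ → K) : sbSeq K α β γ δ 0 q 0 = q 0 := rfl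

/-- `sbSeq 0 q (j+1) = 0`. -/
@[simp] lemma sbSeq_zero_succ (α β γ δ : K) (q : ℕ → K) (j : ℕ) : sbSeq K α β γ δ 0 q (j + 1) = 0 := rfl

/-- the recursion at `j = 0`. -/
lemma sbSeq_succ_zero (α β γ δ : K) (m : ℕ) (q : ℕ → K) :
    sbSeq K α β γ δ (m + 1) q 0 = α * sbSeq K α β γ δ m q 0 + γ * sbSeq K α β γ δ m (shift K q) 0 := rfl

/-- the recursion at `j + 1` (the `y`-identity: `σ(sbSeq (m+1) q) = β·sbSeq m q + δ·sbSeq m (σq)`). -/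
lemma sbSeq_succ_succ (α β γ δ : K) (m : ℕ) (q : ℕ → K) (j : ℕ) :
    sbSeq K α β γ δ (m + 1) q (j + 1) = β * sbSeq K α β γ δ m q j + δ * sbSeq K α β γ δ m (shift K q) j := rfl

/-- `sbSeq m q` vanishes beyond `m`. -/
lemma sbSeq_eq_zero_of_lt (α β γ δ : K) : ∀ (m : ℕ) (q : ℕ → K) {j : ℕ}, m < j → sbSeq K α β γ δ m q j = 0
  | 0, q, j + 1, _ => rfl
  | m + 1, q, j + 1, h => by
    rw [sbSeq_succ_succ, sbSeq_eq_zero_of_lt α β γ δ m q (by omega), sbSeq_eq_zero_of_lt α β γ δ m (shift K q) (by omega), mul_zero, mul_zero, add_zero]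

/-- `sbSeq` is additive in the sequence. -/
lemma sbSeq_add (α β γ δ : K) : ∀ (m : ℕ) (q q' : ℕ → K) (j : ℕ),
    sbSeq K α β γ δ m (fun i => q i + q' i) j = sbSeq K α β γ δ m q j + sbSeq K α β γ δ m q' j
  | 0, _, _, 0 => rfl
  | 0, _, _, _ + 1 => by simp
  | m + 1, q, q', 0 => by
    have hs : shift K (fun i => q i + q' i) = fun i => shift K q i + shift K q' i := rfl
    rw [sbSeq_succ_zero, sbSeq_succ_zero, sbSeq_succ_zero, hs, sbSeq_add α β γ δ m, sbSeq_add α β γ δ m]; ring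
  | m + 1, q, q', j + 1 => by
    have hs : shift K (fun i => q i + q' i) = fun i => shift K q i + shift K q' i := rfl
    rw [sbSeq_succ_succ, sbSeq_succ_succ, sbSeq_succ_succ, hs, sbSeq_add α β γ δ m, sbSeq_add α β γ δ m]; ring

/-- `sbSeq` is homogeneous in the sequence. -/
lemma sbSeq_smul (α β γ δ c : K) : ∀ (m : ℕ) (q : ℕ → K) (j : ℕ), sbSeq K α β γ δ m (fun i => c * q i) j = c * sbSeq K α β γ δ m q j
  | 0, _, 0 => rfl
  | 0, _, _ + 1 => by simp
  | m + 1, q, 0 => by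
    have hs : shift K (fun i => c * q i) = fun i => c * shift K q i := rfl
    rw [sbSeq_succ_zero, sbSeq_succ_zero, hs, sbSeq_smul α β γ δ c m, sbSeq_smul α β γ δ c m]; ring
  | m + 1, q, j + 1 => by
    have hs : shift K (fun i => c * q i) = fun i => c * shift K q i := rfl
    rw [sbSeq_succ_succ, sbSeq_succ_succ, hs, sbSeq_smul α β γ δ c m, sbSeq_smul α β γ δ c m]; ring

/-- `sbSeq m 0 = 0`. -/
lemma sbSeq_zero_seq (α β γ δ : K) (m : ℕ) (j : ℕ) : sbSeq K α β γ δ m (fun _ => 0) j = 0 := by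
  have h := sbSeq_smul K α β γ δ 0 m (fun _ => (0 : K)) j
  simp only [mul_zero, zero_mul] at h
  exact h

/-- **THE `x`-IDENTITY: `sbSeq (m+1) q j = α·sbSeq m q j + γ·sbSeq m (σq) j` for `j ≤ m`** (by induction on `m`; at `j + 1` the two recursions commute). -/
theorem sbSeq_succ_of_le (α β γ δ : K) : ∀ (m : ℕ) (q : ℕ → K) {j : ℕ}, j ≤ m →
    sbSeq K α β γ δ (m + 1) q j = α * sbSeq K α β γ δ m q j + γ * sbSeq K α β γ δ m (shift K q) j
  | _, _, 0, _ => rfl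
  | m + 1, q, j + 1, h => by
    rw [sbSeq_succ_succ, sbSeq_succ_succ, sbSeq_succ_succ, sbSeq_succ_of_le α β γ δ m q (by omega), sbSeq_succ_of_le α β γ δ m (shift K q) (by omega)]
    ring

/-- **THE ONE THEOREM: `Sb α β γ δ (w_m(q)) = w_m(sbSeq α β γ δ m q)` for every `m ≤ n`, every `q` and EVERY `α β γ δ`** — th-7's recursion `w_{m+1}(q) = w_m(q) x_m + w_m(σq) y_m`:
the image is `[α·Sb w_m(q) + γ·Sb w_m(σq)] x_m + [β·Sb w_m(q) + δ·Sb w_m(σq)] y_m`, and the two brackets are `w_m` of the `x`- and `y`-identities of `sbSeq`. -/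
theorem Sb_w (α β γ δ : K) {m : ℕ} (hm : m ≤ n) (q : ℕ → K) : Sb K α β γ δ (w K n m q) = w K n m (sbSeq K α β γ δ m q) := by
  induction m generalizing q with
  | zero => rw [w, w, map_smul, map_one, sbSeq_zero_zero]
  | succ m ih =>
    have hmn : m < n := by omega
    have hX : X K n m = X K n (⟨m, hmn⟩ : Fin n) := rfl
    have hY : Y K n m = Y K n (⟨m, hmn⟩ : Fin n) := rfl
    rw [w, w, map_add, map_mul, map_mul, ih (by omega), ih (by omega), hX, hY, Sb_X, Sb_Y]
    -- the x-bracket and the y-bracket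
    have ex : w K n m (sbSeq K α β γ δ (m + 1) q) = α • w K n m (sbSeq K α β γ δ m q) + γ • w K n m (sbSeq K α β γ δ m (shift K q)) := by
      rw [← w_smul, ← w_smul, ← w_add]
      exact w_eq_of_agree K m fun i hi => sbSeq_succ_of_le K α β γ δ m q hi
    have ey : w K n m (shift K (sbSeq K α β γ δ (m + 1) q)) = β • w K n m (sbSeq K α β γ δ m q) + δ • w K n m (sbSeq K α β γ δ m (shift K q)) := by
      rw [← w_smul, ← w_smul, ← w_add]
      exact w_eq_of_agree K m fun i _ => sbSeq_succ_succ K α β γ δ m q i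
    rw [ex, ey, mul_add, mul_add, add_mul, add_mul, mul_smul_comm, mul_smul_comm, mul_smul_comm, mul_smul_comm, smul_mul_assoc, smul_mul_assoc, smul_mul_assoc,
      smul_mul_assoc]
    abel

/-! ## §122. The generators of the lineage are instances -/

/-- **E5's binomial transform is the moment transform of the shear `x ↦ x + λy`**: `sbSeq 1 λ 0 1 m q j = expMul λ q j` for `j ≤ m`. -/
theorem sbSeq_shear (lam : K) : ∀ (m : ℕ) (q : ℕ → K) {j : ℕ}, j ≤ m → sbSeq K 1 lam 0 1 m q j = expMul K lam q j
  | 0, _, 0, _ => rfl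
  | m + 1, q, 0, _ => by rw [sbSeq_succ_zero, one_mul, zero_mul, add_zero, sbSeq_shear lam m q (Nat.zero_le _)]
  | m + 1, q, j + 1, h => by
    rw [sbSeq_succ_succ, one_mul, sbSeq_shear lam m q (by omega), sbSeq_shear lam m (shift K q) (by omega), expMul_succ]

/-- **E7's reversal is the moment transform of the swap `x ↔ y`**: `sbSeq 0 1 1 0 m q = rev_m q` (everywhere). -/
theorem sbSeq_swap : ∀ (m : ℕ) (q : ℕ → K) (j : ℕ), sbSeq K 0 1 1 0 m q j = rev K m q j
  | 0, q, 0 => by rw [sbSeq_zero_zero, rev_apply_of_le K le_rfl]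
  | 0, q, j + 1 => by rw [sbSeq_zero_succ, rev_apply_of_lt K (Nat.succ_pos j)]
  | m + 1, q, 0 => by
    rw [sbSeq_succ_zero, zero_mul, one_mul, zero_add, sbSeq_swap m, rev_apply_of_le K (Nat.zero_le m), rev_apply_of_le K (Nat.zero_le (m + 1)), shift_apply,
      Nat.sub_zero, Nat.sub_zero]
  | m + 1, q, j + 1 => by
    rw [sbSeq_succ_succ, one_mul, zero_mul, add_zero, sbSeq_swap m q j]
    by_cases h : j ≤ m
    · rw [rev_apply_of_le K h, rev_apply_of_le K (by omega : j + 1 ≤ m + 1), Nat.succ_sub_succ]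
    · rw [rev_apply_of_lt K (by omega), rev_apply_of_lt K (by omega)]

/-- **E12's scaling is the moment transform of `y ↦ μy`**: `sbSeq 1 0 0 μ m q j = scaleSeq μ q j = μ^j q_j` for `j ≤ m`. -/
theorem sbSeq_scale (mu : K) : ∀ (m : ℕ) (q : ℕ → K) {j : ℕ}, j ≤ m → sbSeq K 1 0 0 mu m q j = scaleSeq K mu q j
  | 0, q, 0, _ => by simp only [sbSeq_zero_zero, scaleSeq, pow_zero, one_mul]
  | m + 1, q, 0, _ => by rw [sbSeq_succ_zero, one_mul, zero_mul, add_zero, sbSeq_scale mu m q (Nat.zero_le _)]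
  | m + 1, q, j + 1, h => by
    rw [sbSeq_succ_succ, zero_mul, zero_add, sbSeq_scale mu m (shift K q) (by omega)]
    simp only [scaleSeq, shift_apply, pow_succ]; ring

/-- **F5's x-scaling is the moment transform of `x ↦ dx`**: `sbSeq d 0 0 1 m q j = d^{m−j} q_j` for `j ≤ m` (`= xsSeq_m d q j`). -/
theorem sbSeq_xscale (d : K) : ∀ (m : ℕ) (q : ℕ → K) {j : ℕ}, j ≤ m → sbSeq K d 0 0 1 m q j = d ^ (m - j) * q j
  | 0, q, 0, _ => by rw [sbSeq_zero_zero, Nat.sub_zero, pow_zero, one_mul]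
  | m + 1, q, 0, _ => by rw [sbSeq_succ_zero, zero_mul, add_zero, sbSeq_xscale d m q (Nat.zero_le _), Nat.sub_zero, Nat.sub_zero, pow_succ]; ring
  | m + 1, q, j + 1, h => by rw [sbSeq_succ_succ, zero_mul, zero_add, one_mul, sbSeq_xscale d m (shift K q) (by omega), shift_apply, Nat.succ_sub_succ]

/-- the SINGULAR substitution `x ↦ x + λy`, `y ↦ 0` has moment transform `q ↦ q_0·λ^•` on `[0, m]` (every class goes to the pure class of the frame `λ`). -/
theorem sbSeq_rank_one (lam : K) : ∀ (m : ℕ) (q : ℕ → K) {j : ℕ}, j ≤ m → sbSeq K 1 lam 0 0 m q j = q 0 * lam ^ j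
  | 0, q, 0, _ => by rw [sbSeq_zero_zero, pow_zero, mul_one]
  | m + 1, q, 0, _ => by rw [sbSeq_succ_zero, one_mul, zero_mul, add_zero, sbSeq_rank_one lam m q (Nat.zero_le _)]
  | m + 1, q, j + 1, h => by rw [sbSeq_succ_succ, zero_mul, add_zero, sbSeq_rank_one lam m q (by omega), pow_succ]; ring

/-- **`Φs λ = Sb 1 λ 0 1`** (E5's frame change as an instance). -/
theorem Φs_eq_Sb (lam : K) : (Φs K (n := n) lam : HT K (In n) →ₐ[K] HT K (In n)) = Sb K 1 lam 0 1 :=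
  algHom_ext_XY K (fun a => by rw [AlgEquiv.coe_toAlgHom, Φs_X, Sb_X, one_smul]) (fun a => by rw [AlgEquiv.coe_toAlgHom, Φs_Y, Sb_Y, zero_smul, one_smul, zero_add])

/-- **`Ψs = Sb 0 1 1 0`** (E7's swap). -/
theorem Ψs_eq_Sb : (Ψs K (n := n) : HT K (In n) →ₐ[K] HT K (In n)) = Sb K 0 1 1 0 :=
  algHom_ext_XY K (fun a => by rw [AlgEquiv.coe_toAlgHom, Ψs_X, Sb_X, zero_smul, one_smul, zero_add]) (fun a => by rw [AlgEquiv.coe_toAlgHom, Ψs_Y, Sb_Y, zero_smul, one_smul, add_zero])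

/-- **`Δs μ = Sb 1 0 0 μ`** (E12's scaling). -/
theorem Δs_eq_Sb {mu : K} (hmu : mu ≠ 0) : (Δs K (n := n) hmu : HT K (In n) →ₐ[K] HT K (In n)) = Sb K 1 0 0 mu :=
  algHom_ext_XY K (fun a => by rw [AlgEquiv.coe_toAlgHom, Δs_X, Sb_X, one_smul, zero_smul, add_zero]) (fun a => by rw [AlgEquiv.coe_toAlgHom, Δs_Y, Sb_Y, zero_smul, zero_add])

/-- **`Ls c = Sb 1 0 c 1`** (F1's lower shear). -/
theorem Ls_eq_Sb (c : K) : (Ls K (n := n) c : HT K (In n) →ₐ[K] HT K (In n)) = Sb K 1 0 c 1 :=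
  algHom_ext_XY K (fun a => by rw [AlgEquiv.coe_toAlgHom, Ls_X, Sb_X, one_smul, zero_smul, add_zero]) (fun a => by rw [AlgEquiv.coe_toAlgHom, Ls_Y, Sb_Y, one_smul, add_comm])

/-- **`Xsc d = Sb d 0 0 1`** (F5's x-scaling). -/
theorem Xsc_eq_Sb {d : K} (hd : d ≠ 0) : (Xsc K (n := n) hd : HT K (In n) →ₐ[K] HT K (In n)) = Sb K d 0 0 1 :=
  algHom_ext_XY K (fun a => by rw [AlgEquiv.coe_toAlgHom, Xsc_X, Sb_X, zero_smul, add_zero]) (fun a => by rw [AlgEquiv.coe_toAlgHom, Xsc_Y, Sb_Y, zero_smul, one_smul, zero_add])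

/-- the one theorem SPECIALISES to E5's `Φs_w` (as a class identity in the `sbSeq` language): `w_m(expMul λ q) = w_m(sbSeq 1 λ 0 1 m q)` (`m ≤ n`). -/
theorem w_expMul_eq_w_sbSeq (lam : K) {m : ℕ} (hm : m ≤ n) (q : ℕ → K) : w K n m (expMul K lam q) = w K n m (sbSeq K 1 lam 0 1 m q) := by
  rw [← Φs_w K lam hm, ← AlgEquiv.coe_toAlgHom, Φs_eq_Sb, Sb_w K 1 lam 0 1 hm]

/-- F1's lower shear on the class side: `w_n(lowMul c q) = w_n(sbSeq 1 0 c 1 n q)` (`Ls_w` and the one theorem). -/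
theorem w_lowMul_eq_w_sbSeq (c : K) (q : ℕ → K) : w K n n (lowMul K n c q) = w K n n (sbSeq K 1 0 c 1 n q) := by
  rw [← Ls_w, ← AlgEquiv.coe_toAlgHom, Ls_eq_Sb, Sb_w K 1 0 c 1 le_rfl]

/-- F5's x-scaling on the class side: `w_n(xsSeq d q) = w_n(sbSeq d 0 0 1 n q)`. -/
theorem w_xsSeq_eq_w_sbSeq {d : K} (hd : d ≠ 0) (q : ℕ → K) : w K n n (xsSeq K n d q) = w K n n (sbSeq K d 0 0 1 n q) := by
  rw [← Xsc_w K hd, ← AlgEquiv.coe_toAlgHom, Xsc_eq_Sb, Sb_w K d 0 0 1 le_rfl]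

/-! ## §123. Words in the generators are matrix products -/

/-- **COMPOSITION: `Sb α′ β′ γ′ δ′ ∘ Sb α β γ δ = Sb (αα′ + βγ′) (αβ′ + βδ′) (γα′ + δγ′) (γβ′ + δδ′)`** — substitutions compose by the matrix product
`[[α,β],[γ,δ]]·[[α′,β′],[γ′,δ′]]` (contravariantly: the FIRST substitution is the LEFT factor). -/
theorem Sb_comp (α β γ δ α' β' γ' δ' : K) :
    (Sb K α' β' γ' δ').comp (Sb K (n := n) α β γ δ) = Sb K (α * α' + β * γ') (α * β' + β * δ') (γ * α' + δ * γ') (γ * β' + δ * δ') :=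
  algHom_ext_XY K
    (fun a => by rw [AlgHom.comp_apply, Sb_X, map_add, map_smul, map_smul, Sb_X, Sb_Y, Sb_X]; module)
    (fun a => by rw [AlgHom.comp_apply, Sb_Y, map_add, map_smul, map_smul, Sb_X, Sb_Y, Sb_Y]; module)

/-- composition, applied. -/
theorem Sb_Sb (α β γ δ α' β' γ' δ' : K) (f : HT K (In n)) :
    Sb K α' β' γ' δ' (Sb K α β γ δ f) = Sb K (α * α' + β * γ') (α * β' + β * δ') (γ * α' + δ * γ') (γ * β' + δ * δ') f := by
  rw [← AlgHom.comp_apply, Sb_comp]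

/-- two linear maps out of `K^{2n}` agreeing on every `e_{x_a}` and every `e_{y_a}` are equal. -/
theorem linearMap_ext_xy {M : Type*} [AddCommGroup M] [Module K M] {f g : (In n → K) →ₗ[K] M} (hX : ∀ a : Fin n, f (b K (In n) (Fin.castAdd n a)) = g (b K (In n) (Fin.castAdd n a)))
    (hY : ∀ a : Fin n, f (b K (In n) (Fin.natAdd n a)) = g (b K (In n) (Fin.natAdd n a))) : f = g := by
  refine (b K (In n)).ext fun i => ?_
  rcases lt_or_ge (i : ℕ) n with hi | hi
  · have e : i = Fin.castAdd n ⟨i, hi⟩ := Fin.ext rfl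
    rw [e]; exact hX _
  · have e : i = Fin.natAdd n ⟨i - n, by have := i.2; omega⟩ := Fin.ext (by simp [Fin.natAdd]; omega)
    rw [e]; exact hY _

/-- composition of the substitutions on the generators (the same matrix product as `Sb_comp`). -/
theorem sbLin_comp (α β γ δ α' β' γ' δ' : K) :
    sbLin K α' β' γ' δ' ∘ₗ sbLin K (n := n) α β γ δ = sbLin K (α * α' + β * γ') (α * β' + β * δ') (γ * α' + δ * γ') (γ * β' + δ * δ') :=
  linearMap_ext_xy K
    (fun a => by rw [LinearMap.comp_apply, sbLin_b_castAdd, map_add, map_smul, map_smul, sbLin_b_castAdd, sbLin_b_natAdd, sbLin_b_castAdd]; module)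
    (fun a => by rw [LinearMap.comp_apply, sbLin_b_natAdd, map_add, map_smul, map_smul, sbLin_b_castAdd, sbLin_b_natAdd, sbLin_b_natAdd]; module)

/-- the identity substitution on the generators. -/
theorem sbLin_one : sbLin K (n := n) 1 0 0 1 = LinearMap.id :=
  linearMap_ext_xy K (fun a => by rw [sbLin_b_castAdd, one_smul, zero_smul, add_zero, LinearMap.id_apply])
    (fun a => by rw [sbLin_b_natAdd, zero_smul, one_smul, zero_add, LinearMap.id_apply])

/-- **the identity substitution is the identity.** -/
theorem Sb_one : Sb K (n := n) 1 0 0 1 = AlgHom.id K (HT K (In n)) :=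
  algHom_ext_XY K (fun a => by rw [Sb_X, one_smul, zero_smul, add_zero, AlgHom.id_apply]) (fun a => by rw [Sb_Y, zero_smul, one_smul, zero_add, AlgHom.id_apply])

/-- hence on the class side every WORD in the generators acts by the product matrix: e.g. `Φs μ (Φs λ w_m(q)) = Sb 1 (λ+μ) 0 1 (w_m(q))` — two shears are the shear by the sum
(E9's `expMul_expMul` on the class side). -/
theorem Φs_Φs_eq_Sb (lam mu : K) (f : HT K (In n)) : Φs K mu (Φs K lam f) = Sb K 1 (lam + mu) 0 1 f := by
  rw [← AlgEquiv.coe_toAlgHom (Φs K mu), ← AlgEquiv.coe_toAlgHom (Φs K lam), Φs_eq_Sb, Φs_eq_Sb, Sb_Sb]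
  simp only [one_mul, mul_one, mul_zero, zero_mul, add_zero, zero_add, add_comm mu lam]

/-- **THE SINGULAR SUBSTITUTION `x ↦ x + λy`, `y ↦ 0` SENDS EVERY CLASS TO THE PURE CLASS OF ITS FRAME: `Sb 1 λ 0 0 (w_m(q)) = w_m(q_0·λ^•)`** (`m ≤ n`). -/
theorem Sb_w_rank_one (lam : K) {m : ℕ} (hm : m ≤ n) (q : ℕ → K) : Sb K 1 lam 0 0 (w K n m q) = w K n m (fun j => q 0 * lam ^ j) := by
  rw [Sb_w K 1 lam 0 0 hm]
  exact w_eq_of_agree K m fun i hi => sbSeq_rank_one K lam m q hi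

end Summit.Ventures.HSemireg.Wedge.HankelFrameChange
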